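import Mathlib
import HarnessLib
import HarnessLib.Audit
import Summits.ValiantsHypothesis.ValiantsHypothesis.Theorems.LacunarySymmetroidMatrixDescartesZeroChangeConcavityBudgetDipPosition
import Summits.ValiantsHypothesis.ValiantsHypothesis.Theorems.LacunarySymmetroidMatrixDescartesZeroChangeConcavityBudgetRise

/-!
# ValiantsHypothesis / LacunarySymmetroid — crux `MatrixDescartes` (stmt-ValiantsHypothesis-18050, V1), LINE (A) «product_plus_one»:
# EVERY DIP HAS A RISING ROW — the Wronskian form of the dip inequality, for ANY company

Fifteenth part of the concavity budget.  For ANY company of trinomial rows `g_j = a_{j0} + a_{j1}t^a + a_{j2}t^c` (no sign hypotheses)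
and a dip `t > 0` of `Φ = ∏ g_j` (`Φ′(t) = 0`, `Φ(t) ≠ 0`, `Φ(t)Φ″(t) ≥ 0`):

* `sum_rowWronskian_div_sq_nonneg_of_dip` — `Σ_j W_j(t)/g_j(t)² ≥ 0`, where `W_j = a²a₀a₁t^a + c²a₀a₂t^c + (c−a)²a₁a₂t^{a+c}` is the
  row Wronskian (✓ `rowWronskian_eval`; `W_j/g_j² = t·u_j′` is the slope of the row's push `u_j = t g_j′/g_j`, ✓ `t_mul_deriv_logDeriv_eq`).
  This is ✓ `sum_sq_logDeriv_le_of_dip` (`Σφ_j² ≤ a(a−c)M`) rewritten through ✓ `critical_relation` (`Σ_j θN_j/g_j = a²M + c²T = a(a−c)M`);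
* ★ `exists_rowWronskian_nonneg_of_dip` — hence (`m ≥ 1`) SOME row has `W_j(t) ≥ 0`: every dip sits on a row whose push is RISING at `t`.
  For one-change rows (✓ `…Rise`, ✓ `…Ranges`): a `(+,−,−)` row past its knee, a `(+,+,+)` row, or a `(+,+,−)` row before its maximum —
  never a switched `(+,+,−)` row or an unswitched `(+,−,−)` row.  (Pure `(+,−,−)` quantitative form: ✓ `pureT5_dip_needs_knees`.)

HONEST FRAMING: structural fact at a single dip, any company; def-free, no named facts, no sorry, standard axioms; closes NO stub by name;
`OneChangeFloorK3`, `MatrixDescartes` (stmt-ValiantsHypothesis-18050) OPEN; `VP ≠ VNP` is NOT proved and nothing here bears on it.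

[folklore] Elementary algebra; no citation needed.
-/

set_option linter.dupNamespace false

namespace Summit.ValiantsHypothesis.ValiantsHypothesis.Theorems.LacunarySymmetroidMatrixDescartes

namespace ZeroChange

open Polynomial Finset

/-- **Wronskian form of the dip inequality** (any company): at a dip, `Σ_j W_j(t)/g_j(t)² ≥ 0`. -/
theorem sum_rowWronskian_div_sq_nonneg_of_dip (m a c : ℕ) (co : Fin m → ℝ × ℝ × ℝ) {t : ℝ} (ht : 0 < t)
    (hΦ : (∏ j, row a c (co j).1 (co j).2.1 (co j).2.2).eval t ≠ 0)
    (hcrit : (derivative (∏ j, row a c (co j).1 (co j).2.1 (co j).2.2)).eval t = 0)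
    (hdip : 0 ≤ (∏ j, row a c (co j).1 (co j).2.1 (co j).2.2).eval t *
      (derivative (derivative (∏ j, row a c (co j).1 (co j).2.1 (co j).2.2))).eval t) :
    0 ≤ ∑ j, ((a : ℝ) ^ 2 * (co j).1 * (co j).2.1 * t ^ a + (c : ℝ) ^ 2 * (co j).1 * (co j).2.2 * t ^ c +
        ((c : ℝ) - a) ^ 2 * (co j).2.1 * (co j).2.2 * t ^ (a + c)) / ((row a c (co j).1 (co j).2.1 (co j).2.2).eval t) ^ 2 := by
  have hgt : ∀ j, (row a c (co j).1 (co j).2.1 (co j).2.2).eval t ≠ 0 := by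
    intro j h0; apply hΦ; rw [eval_prod]; exact prod_eq_zero (mem_univ j) h0
  have hrel := critical_relation m a c co hΦ hcrit
  have hdipineq := sum_sq_logDeriv_le_of_dip m a c co ht hΦ hcrit hdip
  -- each summand equals `θN_j/g_j − φ_j²`
  have e : ∀ j, ((a : ℝ) ^ 2 * (co j).1 * (co j).2.1 * t ^ a + (c : ℝ) ^ 2 * (co j).1 * (co j).2.2 * t ^ c +
      ((c : ℝ) - a) ^ 2 * (co j).2.1 * (co j).2.2 * t ^ (a + c)) / ((row a c (co j).1 (co j).2.1 (co j).2.2).eval t) ^ 2 =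
      ((a : ℝ) ^ 2 * (co j).2.1 * t ^ a + (c : ℝ) ^ 2 * (co j).2.2 * t ^ c) / (row a c (co j).1 (co j).2.1 (co j).2.2).eval t -
        (t * (derivative (row a c (co j).1 (co j).2.1 (co j).2.2)).eval t / (row a c (co j).1 (co j).2.1 (co j).2.2).eval t) ^ 2 := by
    intro j
    rw [← rowWronskian_eval]
    have hg := hgt j
    field_simp
  rw [sum_congr rfl fun j _ => e j, sum_sub_distrib]
  -- `Σ θN_j/g_j = a²M + c²T`
  have hθsum : ∑ j, ((a : ℝ) ^ 2 * (co j).2.1 * t ^ a + (c : ℝ) ^ 2 * (co j).2.2 * t ^ c) /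
      (row a c (co j).1 (co j).2.1 (co j).2.2).eval t =
      (a : ℝ) ^ 2 * middleSum a c co t + (c : ℝ) ^ 2 * ∑ j, (co j).2.2 * t ^ c / (row a c (co j).1 (co j).2.1 (co j).2.2).eval t := by
    rw [middleSum, mul_sum, mul_sum, ← sum_add_distrib]
    refine sum_congr rfl fun j _ => ?_
    ring
  rw [hθsum]
  nlinarith [hrel, hdipineq]

/-- ★ **Every dip has a rising row** (any company with `m ≥ 1`): at a dip some row's Wronskian is nonnegative, `W_j(t) ≥ 0`
(the push `u_j = t g_j′/g_j` of that row is non-decreasing at `t`). -/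
theorem exists_rowWronskian_nonneg_of_dip (m a c : ℕ) (hm : 0 < m) (co : Fin m → ℝ × ℝ × ℝ) {t : ℝ} (ht : 0 < t)
    (hΦ : (∏ j, row a c (co j).1 (co j).2.1 (co j).2.2).eval t ≠ 0)
    (hcrit : (derivative (∏ j, row a c (co j).1 (co j).2.1 (co j).2.2)).eval t = 0)
    (hdip : 0 ≤ (∏ j, row a c (co j).1 (co j).2.1 (co j).2.2).eval t *
      (derivative (derivative (∏ j, row a c (co j).1 (co j).2.1 (co j).2.2))).eval t) :
    ∃ j : Fin m, 0 ≤ (a : ℝ) ^ 2 * (co j).1 * (co j).2.1 * t ^ a + (c : ℝ) ^ 2 * (co j).1 * (co j).2.2 * t ^ c +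
        ((c : ℝ) - a) ^ 2 * (co j).2.1 * (co j).2.2 * t ^ (a + c) := by
  have hgt : ∀ j, (row a c (co j).1 (co j).2.1 (co j).2.2).eval t ≠ 0 := by
    intro j h0; apply hΦ; rw [eval_prod]; exact prod_eq_zero (mem_univ j) h0
  have hsum := sum_rowWronskian_div_sq_nonneg_of_dip m a c co ht hΦ hcrit hdip
  by_contra hnone
  push Not at hnone
  have hlt : ∑ j, ((a : ℝ) ^ 2 * (co j).1 * (co j).2.1 * t ^ a + (c : ℝ) ^ 2 * (co j).1 * (co j).2.2 * t ^ c +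
      ((c : ℝ) - a) ^ 2 * (co j).2.1 * (co j).2.2 * t ^ (a + c)) / ((row a c (co j).1 (co j).2.1 (co j).2.2).eval t) ^ 2 < 0 := by
    haveI : Nonempty (Fin m) := ⟨⟨0, hm⟩⟩
    calc ∑ j, ((a : ℝ) ^ 2 * (co j).1 * (co j).2.1 * t ^ a + (c : ℝ) ^ 2 * (co j).1 * (co j).2.2 * t ^ c +
          ((c : ℝ) - a) ^ 2 * (co j).2.1 * (co j).2.2 * t ^ (a + c)) / ((row a c (co j).1 (co j).2.1 (co j).2.2).eval t) ^ 2
        < ∑ _j : Fin m, (0 : ℝ) := sum_lt_sum_of_nonempty univ_nonempty fun j _ =>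
            div_neg_of_neg_of_pos (hnone j) (sq_pos_iff.mpr (hgt j))
      _ = 0 := sum_const_zero
  linarith

end ZeroChange

end Summit.ValiantsHypothesis.ValiantsHypothesis.Theorems.LacunarySymmetroidMatrixDescartes
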